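import Summits.BirchSwinnertonDyer.BirchSwinnertonDyer.Theorems.SlopeDichotomyA2DegenerateLocusA2RegulatorFloorBoundedIndex
import Literature.NumberTheory.EllipticCurves.CanonicalPAdicHeightIntegralityBoundedIndexProofs
import Literature.NumberTheory.EllipticCurves.TamagawaFiniteIndexProofs
import HarnessLib
import Literature.NumberTheory.EllipticCurves.CanonicalPAdicHeightValueSubgroup

/-!
# E4 from print: Mazur–Tate's value subgroup WITH the local terms at the bad primes (exponent to the FIRST
# power) — on corner A2 every pair with `p ∣ ∏c_ℓ` satisfies the regulator–Tamagawa floor, hence T-λ3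

Support file (prover seat `bsd-schneider-i1-c2`, gen 7, cell `bsd-schneider-ideate`; `--supports
stmt-BirchSwinnertonDyer-19086`), fifth of the regulator-floor series (`…RegulatorFloor` p448248 / `…Pub` p448618 /
`…Sharp` p449700 / `…BoundedIndex` p475557) and closing piece of memo ROUTE-P3-v8's «Lemma E4» (§1.3–1.4: on the
pairs where the generator meets a component of order divisible by `p`, the local height off `E⁰` has denominator
`c_ℓ` — not the `k_ℓ²` that the Mazur–Stein–Tate multiple `h(kP)/k²` loses).

THE PRINTED INPUT (§0, cite-tagged NAMED FACT for relocation under `Literature/NumberTheory/EllipticCurves/`;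
nothing asserted). Mazur–Tate 1983 prove by the LOCAL theory of canonical `ρ`-splittings of biextensions
(§1.5, (1.5.2)–(1.5.3); globally §3.3 display after (3.3.4) and (4.1.1)–(4.1.2)) that the canonical `ρ`-pairing
takes values in `Σ_{v∉S}(1/m_{A_v})ρ_v(K_v^*) + Σ_{v∈S}(1/m_{A_v})[ρ_v(K_v^*) + (1/(m_{B_v}n_{A_v}n_{B_v}))ρ_v(𝔬_v^*)]`,
`m_{A_v}` = exponent of the component group `A₀(k_v)/A₀⁰(k_v)`, `n_{A_v}` = exponent of `A₀⁰(k_v)/T_A(k_v)`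
(§1.2), `S` = the places where `ρ` ramifies; and ((4.4) Prop.) that Schneider's analytic height is the
canonical `ρ_c`-pairing, `ρ_c = log_p ∘ χ_cyc`. For `E/ℚ`, `A = B = E`, `ρ = ρ_c` (`S = {p}`, `m_p = 1` at a
good prime, `ρ_c(𝔸_ℚ^*) = log_p(ℤ_p^×) = pℤ_p` for odd `p`, `ρ_ℓ(ℚ_ℓ^*) = ℤ·log_p ℓ ⊆ pℤ_p`) this reads
`ord_p ⟨P, Q⟩ ≥ 1 − max(max_ℓ ord_p m_ℓ, 2·ord_p n_p)` — the sentence already quoted in the docstrings of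
the tree's `CanonicalPAdicHeightIntegralityProofs.lean` / `…AnomalousProofs.lean`, which PROVE its two corners
`p ∤ m_ℓ` (with and without the anomalous term) by the MST route `h(mP)/m²`. The MST route cannot reach the term
`1/m_ℓ` to the first power (it yields `1/k_ℓ²`); the printed theorem does. Stated here in the tree's vocabulary
with the exponents weakened to ORDERS (`m_ℓ ∣ c_ℓ ∣ ∏c_ℓ`, `n_p ∣ #Ẽ(𝔽_p)`):
`‖⟨P, Q⟩‖ ≤ p^{max(ord_p ∏c_ℓ, 2·ord_p #Ẽ(𝔽_p)) − 1}` for THE canonical datum (the σ-pinned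
`PAdicHeightData.IsCanonical` = `(·,·)_{ρ_c}`, MST 2006 §1 fn. 1 / §2.7–2.8, as in the landed adjunction fact
`canonicalPAdicHeight_isogeny_adjoint`).

CONSEQUENCES (§1–§3, kernel-checked). §1: `Reg_p ≠ 0 ⇒ (1 − max(ord_p ∏c_ℓ, 2·ord_p #Ẽ(𝔽_p)))·rank ≤ ord_p Reg_p`.
§2 (corner A2, `ord_p #Ẽ(𝔽_p) = 1`, `rank = 1`): with `t = ord_p ∏c_ℓ ≥ 1`, `ord_p Reg_p ≥ 1 − max(t, 2)` and
`ord_p Reg_p + t ≥ 1 − max(t,2) + t ≥ 0` — **the regulator–Tamagawa floor holds at EVERY A2 pair with `p ∣ ∏c_ℓ`**,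
no index hypothesis, no isogeny. §3: T-λ3 (`λ_an ≠ 1`, `λ_an ≥ 3`) there, and x1b's P₃ road on `{p ∣ ∏c_ℓ}` with the
valued half `v = 1 − max(t, 2)` discharged.

CENSUS (all 2 797 A2 class-pairs `N < 5·10⁵`, g6's kit j257621/j258343 re-tabulated by gen 7): `p ∣ ∏c_ℓ(E₁)` on
1 032 pairs = 190 (`…Sharp`) + 800 (`…BoundedIndex`, road 3) + 42 (road 3 with `c = 2`: 3; road 4
`…HeightIntegralityImage`: 34; residual 5: 11858z1, 225302bd1, 229658c1, 245630t1, 443450cz1 @3) — ALL 1 032 by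
this file modulo the printed fact, INCLUDING the 5; the other 1 765 (`p ∤ ∏c_ℓ(E₁)`) by road 1 (`…Neron`, (red)
structural) — or, since `p ∣ ∏c_ℓ(E₁/Φ)` on every one of them (j257621: never both prime to `p`), by this file
applied to the isogenous member `E₁/Φ` and the λ-transport of the companion `…ValueSubgroupClass.lean`. Residue
of T-λ3 on the census: 0 pairs modulo named facts + per-pair decidable data.

HONEST NOTE. Item 19086 is untouched (DECIDED-REDUCED, gens 0–6; refutation budget re-read gen 7: nothing
certifiable); BSD is not advanced; every theorem is conditional on named facts, one of them (§0) NEW and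
cite-only (a 1983 refereed theorem whose proof — local biextension splittings — the tree cannot yet express:
no local `p`-adic heights). What is NOT claimed: T-λ3 class-wide as a hypothesis-free theorem (the case
`p ∤ ∏c_ℓ` on the whole isogeny class needs road 1's (red) or a member with `p ∣ ∏c_ℓ`).

References: [MazurTate1983Biext] §1.2, §1.5, §3.3, (4.1.1)–(4.1.2), (4.4) Prop.; [MazurSteinTate2006] §1 fn. 1,
§2.7–2.8, §4 p. 19; [BalakrishnanMullerStein2015] Thm. 1.7; [GreenbergVatsal2000] Thm. (1.3); [GreenbergLNM1716]
Prop. 3.10, 5.10; [Wuthrich2014] Thm. 16; memo ROUTE-P3-v8-lambda-g10 §1.3–1.4 (E4); FINDING-i1-c2-g7.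
-/

set_option autoImplicit false

noncomputable section

open scoped Classical MatrixGroups ModularForm

open PowerSeries CongruenceSubgroup WeierstrassCurve Literature.NumberTheory.EllipticCurves
  Literature.NumberTheory.EllipticCurves.ModularForms
  Literature.NumberTheory.EllipticCurves.Rank1Residual
  Literature.NumberTheory.EllipticCurves.Greenberg1999
  Summit.BirchSwinnertonDyer.Rank1Residual
  Summit.BirchSwinnertonDyer.BirchSwinnertonDyer.Theorems.Rank1ResidualX1Defs
  Summit.BirchSwinnertonDyer.Rank1Residual.X1.MuLambda
  Summit.BirchSwinnertonDyer.Rank1Residual.X1.MuPart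
  Summit.BirchSwinnertonDyer.Rank1Residual.X1.ParitySqueeze
  Summit.BirchSwinnertonDyer.BirchSwinnertonDyer.Theses
  Summit.BirchSwinnertonDyer.BirchSwinnertonDyer.Theorems

-- `Summit.BirchSwinnertonDyer.BirchSwinnertonDyer.…`: the summit and its single sub-problem share a name (D-0017 layout).
set_option linter.dupNamespace false

namespace Summit.BirchSwinnertonDyer.BirchSwinnertonDyer.Theorems.DegenerateLocusA2ValueSubgroup

/-! ## §0. The named fact: Mazur–Tate's value subgroup with the local terms (E4 of the memo) -/

variable {W : WeierstrassCurve ℚ} [W.IsElliptic] [W.IsGloballyMinimal] {p : ℕ} [Fact p.Prime]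

/-! ## §1. Class-free: the regulator floor `(1 − ν)·rank ≤ ord_p Reg_p` -/

/-- **`‖Reg_p‖ ≤ (p^{ν−1})^{rank}`, `ν = max(ord_p ∏c_ℓ, 2·ord_p #Ẽ(𝔽_p))`**, for THE canonical datum at an odd good
ordinary prime (ultrametric Hadamard on a Mordell–Weil basis, `norm_padicRegulator_le_pow_of_forall_norm_pairing_le`),
granted the Mazur–Tate value subgroup `hVS`. [cite: MazurTate1983Biext, §3.3 and (4.1.1)–(4.1.2)]
[cite: KunduRay2024, §3 (display before Thm 3.6)] -/
theorem norm_padicRegulator_le_of_valueSubgroup (hVS : Literature.NumberTheory.EllipticCurves.canonicalPAdicHeight_norm_le_valueSubgroup)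
    (hp2 : p ≠ 2) (hgood : W.HasGoodReductionAtPrime p) (hord : ¬ (p : ℤ) ∣ W.frobeniusTrace p)
    {D : PAdicHeightData W p} (hD : D.IsCanonical) :
    ‖padicRegulator D‖ ≤ ((p : ℝ) ^ ((max (padicValNat p W.tamagawaProduct)
        (2 * padicValNat p (W.reductionPointCount p)) : ℤ) - 1)) ^ W.mordellWeilRank :=
  norm_padicRegulator_le_pow_of_forall_norm_pairing_le W p (by positivity) (hVS W p hp2 hgood hord D hD)

/-- **`Reg_p ≠ 0 ⇒ (1 − ν)·rank ≤ ord_p Reg_p`, `ν = max(ord_p ∏c_ℓ, 2·ord_p #Ẽ(𝔽_p))`** (valuation form).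
[cite: MazurTate1983Biext, §3.3 and (4.1.1)–(4.1.2)] -/
theorem valuation_padicRegulator_ge_of_valueSubgroup (hVS : Literature.NumberTheory.EllipticCurves.canonicalPAdicHeight_norm_le_valueSubgroup)
    (hp2 : p ≠ 2) (hgood : W.HasGoodReductionAtPrime p) (hord : ¬ (p : ℤ) ∣ W.frobeniusTrace p)
    {D : PAdicHeightData W p} (hD : D.IsCanonical) (hR : padicRegulator D ≠ 0) :
    (1 - max (padicValNat p W.tamagawaProduct : ℤ) (2 * (padicValNat p (W.reductionPointCount p) : ℤ))) *
        W.mordellWeilRank ≤ (padicRegulator D).valuation := by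
  have hpp : p.Prime := Fact.out
  have hp1 : (1 : ℝ) < p := by exact_mod_cast hpp.one_lt
  have h := norm_padicRegulator_le_of_valueSubgroup hVS hp2 hgood hord hD
  rw [Padic.norm_eq_zpow_neg_valuation hR, ← zpow_natCast, ← zpow_mul] at h
  have h' := (zpow_le_zpow_iff_right₀ hp1).mp h
  linarith

/-! ## §2. Corner A2: the regulator–Tamagawa floor at EVERY pair with `p ∣ ∏c_ℓ` -/

/-- **On corner A2, `1 − max(ord_p ∏c_ℓ, 2) ≤ ord_p Reg_p`** (the `max` taken in `ℤ`) for THE canonical regulator whenever it is non-zero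
(`ord_p #Ẽ(𝔽_p) = 1` on the leaf, `rank = 1` by GZK), granted the Mazur–Tate value subgroup.
[cite: MazurTate1983Biext, §3.3 and (4.1.1)–(4.1.2)] [cite: MazurSteinTate2006, §4 p. 19] -/
theorem valuation_padicRegulator_ge_of_typeBRankOne_of_valueSubgroup
    (hVS : Literature.NumberTheory.EllipticCurves.canonicalPAdicHeight_norm_le_valueSubgroup) (hGZK : rank_eq_analyticRank_of_analyticRank_le_one)
    (hB : X1.TypeBRankOne W p) {Dh : PAdicHeightData W p} (hDh : Dh.IsCanonical) (hR : padicRegulator Dh ≠ 0) :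
    1 - max (padicValNat p W.tamagawaProduct : ℤ) 2 ≤ (padicRegulator Dh).valuation := by
  have hX := isClassX1_of_classX1 hB.1
  have hL : X1.RankOne.Leaf W p := X1.RankOne.leaf_of_classX1 hB.1 hB.2.1
  have h := valuation_padicRegulator_ge_of_valueSubgroup hVS hX.two_ne hX.hasGoodReductionAtPrime
    hX.not_dvd_frobeniusTrace hDh hR
  obtain ⟨hrk, -⟩ := hGZK W hB.2.1.le
  have hr1 : (W.mordellWeilRank : ℤ) = 1 := by exact_mod_cast hrk.trans hB.2.1
  rw [hL.padicValNat_reductionPointCount_eq_one, hr1, mul_one] at h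
  simpa using h

/-- **The regulator–Tamagawa floor at every A2 pair with `p ∣ ∏c_ℓ`** (the binder `hRT` of
`…RegulatorFloorPub.not_analyticLambdaEq_one_of_typeBRankOne_of_regTamFloor`): with `t = ord_p ∏c_ℓ ≥ 1`,
`ord_p Reg_p + t ≥ 1 − max(t, 2) + t ≥ 0`. No index hypothesis, no isogeny; granted the Mazur–Tate value subgroup
(E4 of memo ROUTE-P3-v8) and GZK. Census: all 1 032 A2 class-pairs with `p ∣ ∏c_ℓ(E₁)`, including the 5 that
roads 1–4 miss. [cite: MazurTate1983Biext, §3.3 and (4.1.1)–(4.1.2)] [cite: MazurSteinTate2006, §4 p. 19] -/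
theorem regTamFloor_of_typeBRankOne_of_dvd_tamagawa_of_valueSubgroup
    (hVS : Literature.NumberTheory.EllipticCurves.canonicalPAdicHeight_norm_le_valueSubgroup) (hGZK : rank_eq_analyticRank_of_analyticRank_le_one)
    (hB : X1.TypeBRankOne W p) (hTam : p ∣ W.tamagawaProduct) :
    ∀ Dh : PAdicHeightData W p, Dh.IsCanonical → padicRegulator Dh ≠ 0 →
      0 ≤ (padicRegulator Dh).valuation + (padicValNat p W.tamagawaProduct : ℤ) := by
  intro Dh hDh hR
  have h := valuation_padicRegulator_ge_of_typeBRankOne_of_valueSubgroup hVS hGZK hB hDh hR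
  have hpos : 0 < W.tamagawaProduct := W.tamagawaProduct_pos_holds
  have h1 : 1 ≤ padicValNat p W.tamagawaProduct := one_le_padicValNat_of_dvd hpos.ne' hTam
  have h1' : (1 : ℤ) ≤ (padicValNat p W.tamagawaProduct : ℤ) := by exact_mod_cast h1
  rcases le_total (padicValNat p W.tamagawaProduct : ℤ) 2 with hle | hge
  · rw [max_eq_right hle] at h
    linarith
  · rw [max_eq_left hge] at h
    linarith

/-! ## §3. T-λ3 at every A2 pair with `p ∣ ∏c_ℓ`, and the P₃ road there -/

/-- **T-λ3 on `{p ∣ ∏c_ℓ} ∩ A2` (memo ROUTE-P3-v8 (T1) + E4 from print): `λ_an ≠ 1`** at every A2 pair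
`(W, p)` with `p ∣ ∏c_ℓ(W)` — published inputs BY NAME only (W16, Perrin-Riou–Schneider = BMS 1.7, GV Thm. 1.3,
Greenberg Prop. 5.10, Mazur–Tate σ, modularity, GZK, and Mazur–Tate 1983 §3.3/(4.1.1) `hVS`) plus the one
decidable datum `p ∣ ∏c_ℓ`; NO height value inspected, NO index hypothesis, NO isogeny.
[cite: MazurTate1983Biext, §3.3 and (4.1.1)–(4.1.2)] [cite: BalakrishnanMullerStein2015, Thm. 1.7]
[cite: GreenbergVatsal2000, Thm. (1.3)] [cite: GreenbergLNM1716, Prop. 5.10 (PDF p. 147)]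
[cite: Wuthrich2014, Thm. 16 (p. 393)] -/
theorem not_analyticLambdaEq_one_of_typeBRankOne_of_dvd_tamagawa_of_valueSubgroup
    (hW16 : Wuthrich2014.charIdeal_dvd_padicLFunction) (hS : Schneider1985_order_charGenerator_odd)
    (hGV : GreenbergVatsal2000.thm13_charIdeal_eq_of_gvPar)
    (h510 : prop510_isTorsion_hasUnitContent_of_gvPar) (hMT : mazur_tate_sigma_exists_odd)
    (hmodP : nonempty_modularParametrizationData) (hGZK : rank_eq_analyticRank_of_analyticRank_le_one)
    (hVS : Literature.NumberTheory.EllipticCurves.canonicalPAdicHeight_norm_le_valueSubgroup)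
    (hB : X1.TypeBRankOne W p) (hTam : p ∣ W.tamagawaProduct) : ¬ AnalyticLambdaEq W p 1 :=
  DegenerateLocusA2RegulatorFloorPub.not_analyticLambdaEq_one_of_typeBRankOne_of_regTamFloor hW16 hS hGV
    h510 hMT hmodP hGZK hB (regTamFloor_of_typeBRankOne_of_dvd_tamagawa_of_valueSubgroup hVS hGZK hB hTam)

/-- **T-λ3, counted form, on `{p ∣ ∏c_ℓ} ∩ A2`: every certified `λ_an = n` has `n ≥ 3`** (λ-parity on rank one
excludes `λ_an = 2`). [cite: MazurTate1983Biext, §3.3 and (4.1.1)–(4.1.2)]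
[cite: GreenbergVatsal2000, Thm. (1.3)] [cite: MazurTateTeitelbaum1986Invent, §I.17–I.18]
[cite: BalakrishnanMullerStein2015, Thm. 1.7] -/
theorem three_le_of_analyticLambdaEq_of_typeBRankOne_of_dvd_tamagawa_of_valueSubgroup
    (hW16 : Wuthrich2014.charIdeal_dvd_padicLFunction) (hS : Schneider1985_order_charGenerator_odd)
    (hGV : GreenbergVatsal2000.thm13_charIdeal_eq_of_gvPar)
    (h510 : prop510_isTorsion_hasUnitContent_of_gvPar) (hMT : mazur_tate_sigma_exists_odd)
    (hmodP : nonempty_modularParametrizationData) (hGZK : rank_eq_analyticRank_of_analyticRank_le_one)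
    (hVS : Literature.NumberTheory.EllipticCurves.canonicalPAdicHeight_norm_le_valueSubgroup)
    (hB : X1.TypeBRankOne W p) (hTam : p ∣ W.tamagawaProduct) {n : ℕ} (hn : AnalyticLambdaEq W p n) :
    3 ≤ n :=
  DegenerateLocusA2RegulatorFloorPub.three_le_of_analyticLambdaEq_of_typeBRankOne_of_regTamFloor hW16 hS hGV
    h510 hMT hmodP hGZK hB (regTamFloor_of_typeBRankOne_of_dvd_tamagawa_of_valueSubgroup hVS hGZK hB hTam) hn

/-- **P₃ on `{p ∣ ∏c_ℓ} ∩ A2` from the BARE Schneider certificate** (E4 from print discharges the valued half: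
`v = 1 − max(ord_p ∏c_ℓ, 2)`): `λ_an = 3` and `Reg_p ≠ 0` for every canonical datum ⇒ Mazur's MC ∧ BSD(E,p) — x1b's
`RankOne.Leaf.mazurMainConjecture_and_bsdp_of_lamThree` with `μ_an = 0` from GV 1.3 + Greenberg 5.10, the μ-part
from W16, `htors` from type B, and `hb : 0 + 0 + 1 < v + ord ∏c_ℓ + 2` from `v + ord ∏c_ℓ ≥ 0`. Supersedes
`…Sharp`/`…BoundedIndex` §4 (index hypotheses) on this locus. Granted W16, Perrin-Riou–Schneider, PR87,
Mazur–Tate σ, modularity, GZK, Greenberg 3.10/5.10, GV 1.3 and MT83 §3.3 by name.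
[cite: MazurTate1983Biext, §3.3 and (4.1.1)–(4.1.2)] [cite: GreenbergLNM1716, Prop. 3.10 and §5 p. 183]
[cite: Wuthrich2014, Thm. 16 (p. 393)] [cite: BalakrishnanMullerStein2015, Thm. 1.7] -/
theorem mazurMainConjecture_and_bsdp_of_typeBRankOne_of_lamThree_of_schneider_of_valueSubgroup
    (hW16 : Wuthrich2014.charIdeal_dvd_padicLFunction) (hS : Schneider1985_order_charGenerator_odd)
    (hPR : perrinRiou_rankOne_leadingTerms_odd) (hMT : mazur_tate_sigma_exists_odd)
    (hmodP : nonempty_modularParametrizationData) (hGZK : rank_eq_analyticRank_of_analyticRank_le_one)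
    (h310 : prop310_selmerCorank_mod_two_eq_lambdaInvariant)
    (hGV : GreenbergVatsal2000.thm13_charIdeal_eq_of_gvPar)
    (h510 : prop510_isTorsion_hasUnitContent_of_gvPar) (hVS : Literature.NumberTheory.EllipticCurves.canonicalPAdicHeight_norm_le_valueSubgroup)
    (hB : X1.TypeBRankOne W p) (hTam : p ∣ W.tamagawaProduct) (hlam3 : AnalyticLambdaEq W p 3)
    (hSch : ∀ Dh : PAdicHeightData W p, Dh.IsCanonical → padicRegulator Dh ≠ 0) :
    MazurMainConjecture W p ∧ BSDp W p := by
  have hX := isClassX1_of_classX1 hB.1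
  have hL : X1.RankOne.Leaf W p := X1.RankOne.leaf_of_classX1 hB.1 hB.2.1
  have hμ0 : AnalyticMuLE W p 0 :=
    DegenerateLocusA2RegulatorFloorPub.analyticMuLE_zero_of_typeBRankOne hGV h510 hB
  have hμ : MuPartAt W p := muPartAt_of_analyticMuLE_zero hW16 hX.two_ne hX.hasGoodReductionAtPrime
    hX.not_dvd_frobeniusTrace hX.not_hasIrreducibleModPGaloisRep hμ0
  refine hL.mazurMainConjecture_and_bsdp_of_lamThree hW16 hS hPR hMT hmodP hGZK h310 hμ0 hμ hlam3
    (v := 1 - max (padicValNat p W.tamagawaProduct : ℤ) 2) (fun Dh hDh ↦ ⟨hSch Dh hDh,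
      valuation_padicRegulator_ge_of_typeBRankOne_of_valueSubgroup hVS hGZK hB hDh (hSch Dh hDh)⟩) ?_
  have ht : (padicValNat p W.torsionOrder : ℤ) = 0 := by
    exact_mod_cast padicValNat.eq_zero_of_not_dvd
      (DegenerateLocusA2RegulatorFloor.not_dvd_torsionOrder_of_typeBRankOne W p hB)
  have hN : (padicValNat p (W.reductionPointCount p) : ℤ) = 1 := by
    exact_mod_cast hL.padicValNat_reductionPointCount_eq_one
  have hpos : 0 < W.tamagawaProduct := W.tamagawaProduct_pos_holds
  have h1 : 1 ≤ padicValNat p W.tamagawaProduct := one_le_padicValNat_of_dvd hpos.ne' hTam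
  rw [ht, hN]
  have h1' : (1 : ℤ) ≤ (padicValNat p W.tamagawaProduct : ℤ) := by exact_mod_cast h1
  rcases le_total (padicValNat p W.tamagawaProduct : ℤ) 2 with hle | hge
  · rw [max_eq_right hle]
    push_cast
    linarith
  · rw [max_eq_left hge]
    push_cast
    linarith

end Summit.BirchSwinnertonDyer.BirchSwinnertonDyer.Theorems.DegenerateLocusA2ValueSubgroup

end
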